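import Summits.QuantumAdvantage.QuantumAdvantage.Theorems.InnerDegreeLawsC

set_option linter.dupNamespace false

/-!
# InnerDegreeLawsD (lens 4, g27; part D of 4) — LAW C⁺ (per-register sparsity suffices: surviving nonlinear bits are forms) and its first-moment form (pair-sparse quadratic parts die)

Blocker `X = AbsorptionDial.NoPerfectPolyOdd` (item 28487); decomp-qadv lens 4 (minimal-counterexample / extremal reduction), g27.  The NODE record
(rung `QuadFormNoPerfectOdd`, residual `QuadLiftOdd`, sub-rung `OneQuadNoPerfectOdd`, floor `linFormFloor`, `x_iff_pieces`) lives in the cell file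
`g27/InnerDegreeDial.lean` and is NOT landed (Prop-definition node pieces); the tree parts are Prop-definition-free and state only unconditional LAWS.
Kernel-checked content:

* §7 **LAW C⁺ (`loss_of_fewBits`, `loss_of_affinePlusBits`, `loss_of_sparseQuad`).**  LAW C tolerates, per register, `r` free bits read
  directly besides the `k` forms (a bit is a form: count with `p^(k+r)`); hence an extra inner function that is AFFINE + any function of `r`
  surviving bits on the subcube is absorbed, and at the quadratic grade it suffices that each register's surviving OFF-DIAGONAL support on
  the subcube touches `≤ r` free positions — PER REGISTER, no common independent set (`r = 0` is LAW Q).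
* §9 **LAW C⁺, first-moment form (`loss_of_pairSparseQuad`).**  With `B = badSets M` (unions of two supported pairs of ONE register), the
  avoiding `m`-set leaves every register at most one surviving pair (`r = 2`): per-register-SPARSE quadratic parts (e.g. `O(n)` supported
  pairs each, such as the «spread matching inner products», once `n ≫ m⁴`) are never perfect — the rung's residual shrinks to «some register
  carries a DENSE generic quadratic»; minimal suspect: `n` linear-test registers + ONE dense quadratic register (NODE-g27 §3 (c0)).
-/

open Finset
open Summit.QuantumAdvantage.AdviceFreeQNC0

namespace Summit.QuantumAdvantage.QuantumAdvantage.Theorems.InnerDegreeDial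

/-! ### §7 LAW C⁺: few surviving nonlinear BITS suffice — per-register sparsity on a subcube (no common independent set needed) -/

section LawCplus

variable {p : ℕ} [Fact p.Prime]

/-- **LAW C⁺ (few extra bits).**  On the subcube, each register is a function of `k` linear forms `mod p` of the free bits AND of
`r` free bits read directly (positions `J g : Fin r → Fin m`, per register); a bit is itself a linear form, so the register is a
`(k+r)`-form register there and LAW C applies with `p^(k+r)`. -/
theorem loss_of_fewBits (hp5 : 5 ≤ p) {n m k r : ℕ}
    (hcount : (n + 1) * (p ^ (k + r) * 2) * (2 * p - 1) ^ m < (2 * p) ^ m) (c : ℕ)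
    (y : Fin (n + 1) → (Fin n → Bool) → Bool) (ρ : Fin n → Bool) (T : Fin m ↪ Fin n)
    (lam : Fin (n + 1) → Fin k → Fin m → ZMod p) (J : Fin (n + 1) → Fin r → Fin m)
    (F : Fin (n + 1) → (Fin k → ZMod p) → (Fin r → Bool) → Bool)
    (hy : ∀ g v, y g (fill ρ T v) = F g (fun j => ∑ i, if v i = true then lam g j i else 0) (fun i => v (J g i))) :
    ∃ v, ringWinU c y (fill ρ T v) = false := by
  classical
  let lam' : Fin (n + 1) → Fin (k + r) → Fin m → ZMod p :=
    fun g => Fin.append (lam g) (fun i => fun i' => if i' = J g i then 1 else 0)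
  let F' : Fin (n + 1) → (Fin (k + r) → ZMod p) → Bool :=
    fun g x => F g (fun j => x (Fin.castAdd r j)) (fun i => decide (x (Fin.natAdd k i) = 1))
  refine loss_on_kForm_subcube hp5 hcount c y ρ T lam' F' fun g v => ?_
  rw [hy g v]
  have hbit : ∀ i : Fin r, (∑ i', if v i' = true then lam' g (Fin.natAdd k i) i' else 0) = if v (J g i) = true then 1 else 0 := by
    intro i
    simp only [lam', Fin.append_right]
    rw [Finset.sum_eq_single (J g i)]
    · simp
    · intro i' _ hne
      simp [hne]
    · simp
  show F g _ _ = F g _ _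
  congr 1
  · funext j
    simp only [lam', Fin.append_left]
  · funext i
    dsimp only
    simp only [hbit i]
    cases v (J g i) <;> simp

/-- **LAW Q⁺ (affine plus a function of few bits).**  If each extra inner function `q g` restricts on the subcube to an AFFINE function of
the free bits plus an arbitrary function `h g` of `r` of them (`J g : Fin r → Fin m`), the register is a function of `k+1` forms and `r`
bits there: loss once the count holds with `p^(k+1+r)`.  (`r = 0` is LAW Q.) -/
theorem loss_of_affinePlusBits (hp5 : 5 ≤ p) {n m k r : ℕ}
    (hcount : (n + 1) * (p ^ (k + 1 + r) * 2) * (2 * p - 1) ^ m < (2 * p) ^ m) (c : ℕ)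
    (y : Fin (n + 1) → (Fin n → Bool) → Bool) (ρ : Fin n → Bool) (T : Fin m ↪ Fin n)
    (lam : Fin (n + 1) → Fin k → Fin n → ZMod p) (q : Fin (n + 1) → (Fin n → Bool) → ZMod p)
    (F : Fin (n + 1) → (Fin k → ZMod p) → ZMod p → Bool)
    (hy : ∀ g u, y g u = F g (fun j => ∑ i, if u i = true then lam g j i else 0) (q g u))
    (J : Fin (n + 1) → Fin r → Fin m) (h : Fin (n + 1) → (Fin r → Bool) → ZMod p)
    (hq : ∀ g, ∃ (C : ZMod p) (β : Fin m → ZMod p), ∀ v,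
      q g (fill ρ T v) = C + (∑ j, if v j = true then β j else 0) + h g (fun i => v (J g i))) :
    ∃ v, ringWinU c y (fill ρ T v) = false := by
  classical
  choose C β hCβ using hq
  let α : Fin (n + 1) → Fin k → ZMod p := fun g j => ∑ i ∈ (univ.map T)ᶜ, if ρ i = true then lam g j i else 0
  let lam' : Fin (n + 1) → Fin (k + 1) → Fin m → ZMod p :=
    fun g => Fin.snoc (α := fun _ => Fin m → ZMod p) (fun j j' => lam g j (T j')) (β g)
  let F' : Fin (n + 1) → (Fin (k + 1) → ZMod p) → (Fin r → Bool) → Bool :=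
    fun g x w => F g (fun j => α g j + x (Fin.castSucc j)) (C g + x (Fin.last k) + h g w)
  refine loss_of_fewBits hp5 hcount c y ρ T lam' J F' fun g v => ?_
  rw [hy g (fill ρ T v), hCβ g v]
  show F g _ _ = F g _ _
  congr 1
  · funext j
    rw [linForm_fill]
    simp [lam', α, Fin.snoc_castSucc]
  · simp [lam', Fin.snoc_last]


/-! #### the quadratic grade of LAW C⁺: quadratic parts whose surviving off-diagonal block on the subcube touches only `r` free bits -/

variable {n : ℕ}

/-- the matrix with its `T × T` block removed -/
def blockOff {m : ℕ} (M : Fin n → Fin n → ZMod p) (T : Fin m ↪ Fin n) : Fin n → Fin n → ZMod p :=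
  fun i i' => if (∃ j, T j = i) ∧ (∃ j', T j' = i') then 0 else M i i'

/-- the `T × T` block alone -/
def blockOn {m : ℕ} (M : Fin n → Fin n → ZMod p) (T : Fin m ↪ Fin n) : Fin n → Fin n → ZMod p :=
  fun i i' => if (∃ j, T j = i) ∧ (∃ j', T j' = i') then M i i' else 0

/-- the off-block part vanishes on `T × T` -/
theorem blockOff_T {m : ℕ} (M : Fin n → Fin n → ZMod p) (T : Fin m ↪ Fin n) (j j' : Fin m) :
    blockOff M T (T j) (T j') = 0 := by
  unfold blockOff
  rw [if_pos ⟨⟨j, rfl⟩, ⟨j', rfl⟩⟩]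

/-- block decomposition of a matrix along `T` -/
theorem blockOff_add_blockOn {m : ℕ} (M : Fin n → Fin n → ZMod p) (T : Fin m ↪ Fin n) (i i' : Fin n) :
    blockOff M T i i' + blockOn M T i i' = M i i' := by
  unfold blockOff blockOn
  split_ifs <;> simp

/-- the quadratic term `[u_i][u_{i'}]·a` is additive in `a` -/
theorem qterm_add (u : Fin n → Bool) (i i' : Fin n) (a a' : ZMod p) :
    (if u i = true then (if u i' = true then a + a' else 0) else 0)
      = (if u i = true then (if u i' = true then a else 0) else 0) + (if u i = true then (if u i' = true then a' else 0) else 0) := by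
  split_ifs <;> simp

/-- splitting off the `T × T` block at a point of the subcube -/
theorem quadVal_fill_block {m : ℕ} (M : Fin n → Fin n → ZMod p) (b : Fin n → ZMod p) (ρ : Fin n → Bool) (T : Fin m ↪ Fin n)
    (v : Fin m → Bool) :
    quadVal M b (fill ρ T v) = quadVal (blockOff M T) b (fill ρ T v)
      + ∑ j, ∑ j', if v j = true then (if v j' = true then M (T j) (T j') else 0) else 0 := by
  classical
  set u := fill ρ T v with hu
  have hM : (∑ i, ∑ i', if u i = true then (if u i' = true then M i i' else 0) else 0)
      = (∑ i, ∑ i', if u i = true then (if u i' = true then blockOff M T i i' else 0) else 0)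
        + ∑ i, ∑ i', if u i = true then (if u i' = true then blockOn M T i i' else 0) else 0 := by
    rw [← sum_add_distrib]
    refine sum_congr rfl fun i _ => ?_
    rw [← sum_add_distrib]
    refine sum_congr rfl fun i' _ => ?_
    rw [← qterm_add, blockOff_add_blockOn]
  -- the block part only sees free coordinates
  have hon : (∑ i, ∑ i', if u i = true then (if u i' = true then blockOn M T i i' else 0) else 0)
      = ∑ j, ∑ j', if v j = true then (if v j' = true then M (T j) (T j') else 0) else 0 := by
    have hzero_out : ∀ i, i ∈ (univ.map T)ᶜ → ∀ i', blockOn M T i i' = 0 := by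
      intro i hi i'
      unfold blockOn
      rw [if_neg]
      rintro ⟨⟨j, hj⟩, _⟩
      exact (mem_compl.mp hi) (mem_map.mpr ⟨j, mem_univ _, hj⟩)
    have hzero_out' : ∀ i', i' ∈ (univ.map T)ᶜ → ∀ i, blockOn M T i i' = 0 := by
      intro i' hi' i
      unfold blockOn
      rw [if_neg]
      rintro ⟨_, ⟨j', hj'⟩⟩
      exact (mem_compl.mp hi') (mem_map.mpr ⟨j', mem_univ _, hj'⟩)
    rw [sum_split T]
    have hrest : (∑ i ∈ (univ.map T)ᶜ, ∑ i', if u i = true then (if u i' = true then blockOn M T i i' else 0) else 0) = 0 := by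
      refine sum_eq_zero fun i hi => sum_eq_zero fun i' _ => ?_
      rw [hzero_out i hi i']
      split_ifs <;> rfl
    rw [hrest, add_zero]
    refine sum_congr rfl fun j _ => ?_
    rw [sum_split T]
    have hrest' : (∑ i' ∈ (univ.map T)ᶜ, if u (T j) = true then (if u i' = true then blockOn M T (T j) i' else 0) else 0) = 0 := by
      refine sum_eq_zero fun i' hi' => ?_
      rw [hzero_out' i' hi' (T j)]
      split_ifs <;> rfl
    rw [hrest', add_zero]
    refine sum_congr rfl fun j' _ => ?_
    have hblk : blockOn M T (T j) (T j') = M (T j) (T j') := by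
      unfold blockOn
      rw [if_pos ⟨⟨j, rfl⟩, ⟨j', rfl⟩⟩]
    rw [hu, fill_app, fill_app, hblk]
  unfold quadVal
  rw [hM, hon]
  ring

/-- diagonal / off-diagonal split of the block term (`v_j² = v_j` makes the diagonal linear) -/
theorem block_split {m : ℕ} (M : Fin n → Fin n → ZMod p) (T : Fin m ↪ Fin n) (v : Fin m → Bool) :
    (∑ j, ∑ j', if v j = true then (if v j' = true then M (T j) (T j') else 0) else 0)
      = (∑ j, if v j = true then M (T j) (T j) else 0)
        + ∑ j, ∑ j', if j = j' then 0 else (if v j = true then (if v j' = true then M (T j) (T j') else 0) else 0) := by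
  classical
  rw [← sum_add_distrib]
  refine sum_congr rfl fun j _ => ?_
  have hdiag : (if v j = true then M (T j) (T j) else 0)
      = ∑ j', if j = j' then (if v j = true then (if v j' = true then M (T j) (T j') else 0) else 0) else 0 := by
    rw [sum_ite_eq]
    simp only [mem_univ, if_true]
    split_ifs <;> rfl
  rw [hdiag, ← sum_add_distrib]
  refine sum_congr rfl fun j' _ => ?_
  split_ifs <;> simp

/-- reading the free bit at position `j` through the position list `J` (false if `j` is not listed) -/
def bitOf {m r : ℕ} (J : Fin r → Fin m) (w : Fin r → Bool) (j : Fin m) : Bool :=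
  if h : ∃ i, J i = j then w (Fin.find _ h) else false

/-- reading a designated bit through the index map `J` -/
theorem bitOf_comp {m r : ℕ} (J : Fin r → Fin m) (v : Fin m → Bool) {j : Fin m} (hj : ∃ i, J i = j) :
    bitOf J (fun i => v (J i)) j = v j := by
  unfold bitOf
  rw [dif_pos hj]
  have h := Fin.find_spec (p := fun i => J i = j) hj
  simp only at h ⊢
  rw [h]

/-- the off-diagonal `T × T` block as a function of the `r` bits at positions `J` -/
def offBlock {m r : ℕ} (M : Fin n → Fin n → ZMod p) (T : Fin m ↪ Fin n) (J : Fin r → Fin m) (w : Fin r → Bool) : ZMod p :=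
  ∑ j, ∑ j', if j = j' then 0 else (if bitOf J w j = true then (if bitOf J w j' = true then M (T j) (T j') else 0) else 0)

/-- the surviving off-diagonal block read through the index map `J` -/
theorem offBlock_comp {m r : ℕ} (M : Fin n → Fin n → ZMod p) (T : Fin m ↪ Fin n) (J : Fin r → Fin m)
    (hsupp : ∀ j j', j ≠ j' → M (T j) (T j') ≠ 0 → (∃ i, J i = j) ∧ (∃ i, J i = j')) (v : Fin m → Bool) :
    offBlock M T J (fun i => v (J i))
      = ∑ j, ∑ j', if j = j' then 0 else (if v j = true then (if v j' = true then M (T j) (T j') else 0) else 0) := by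
  unfold offBlock
  refine sum_congr rfl fun j _ => sum_congr rfl fun j' _ => ?_
  by_cases hjj : j = j'
  · rw [if_pos hjj, if_pos hjj]
  rw [if_neg hjj, if_neg hjj]
  by_cases hM : M (T j) (T j') = 0
  · simp [hM]
  · obtain ⟨hj, hj'⟩ := hsupp j j' hjj hM
    rw [bitOf_comp J v hj, bitOf_comp J v hj']

/-- a quadratic polynomial whose surviving off-diagonal block on the subcube is supported on the positions `J` restricts to
AFFINE + a function of those `r` bits -/
theorem quadVal_fill_sparse {m r : ℕ} (M : Fin n → Fin n → ZMod p) (b : Fin n → ZMod p) (ρ : Fin n → Bool) (T : Fin m ↪ Fin n)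
    (J : Fin r → Fin m) (hsupp : ∀ j j', j ≠ j' → M (T j) (T j') ≠ 0 → (∃ i, J i = j) ∧ (∃ i, J i = j')) :
    ∃ (C : ZMod p) (β : Fin m → ZMod p), ∀ v,
      quadVal M b (fill ρ T v) = C + (∑ j, if v j = true then β j else 0) + offBlock M T J (fun i => v (J i)) := by
  classical
  obtain ⟨C, β, hCβ⟩ := quadVal_fill_affine (blockOff M T) b ρ T (blockOff_T M T)
  refine ⟨C, fun j => β j + M (T j) (T j), fun v => ?_⟩
  rw [quadVal_fill_block, hCβ v, block_split, offBlock_comp M T J hsupp v]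
  have hlin : (∑ j, if v j = true then β j + M (T j) (T j) else 0)
      = (∑ j, if v j = true then β j else 0) + ∑ j, if v j = true then M (T j) (T j) else 0 := by
    rw [← sum_add_distrib]
    refine sum_congr rfl fun j _ => ?_
    split_ifs <;> simp
  rw [hlin]
  ring

/-- **LAW C⁺ at the quadratic grade (per-register sparsity).**  Registers = tables of `k` linear forms and one quadratic polynomial; if on
the subcube `fill ρ T ·` the surviving OFF-DIAGONAL support of each register's quadratic part touches only the `r` free positions `J g`
(per register — no common independent set is asked for), then the strategy loses there once `(n+1)·2p^(k+1+r)·(2p−1)^m < (2p)^m`.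
With `r = 0` this is LAW Q; `r = 2` = «at most one surviving pair per register», which a first-moment subcube provides for every family of
quadratic graphs with `O(n)` edges and bounded degree (§ first-moment lemma below): the «spread matching-IP» suspects are dead. -/
theorem loss_of_sparseQuad (hp5 : 5 ≤ p) {m k r : ℕ}
    (hcount : (n + 1) * (p ^ (k + 1 + r) * 2) * (2 * p - 1) ^ m < (2 * p) ^ m) (c : ℕ)
    (y : Fin (n + 1) → (Fin n → Bool) → Bool)
    (lam : Fin (n + 1) → Fin k → Fin n → ZMod p) (M : Fin (n + 1) → Fin n → Fin n → ZMod p) (b : Fin (n + 1) → Fin n → ZMod p)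
    (F : Fin (n + 1) → (Fin k → ZMod p) → ZMod p → Bool)
    (hy : ∀ g u, y g u = F g (fun j => ∑ i, if u i = true then lam g j i else 0) (quadVal (M g) (b g) u))
    (T : Fin m ↪ Fin n) (ρ : Fin n → Bool) (J : Fin (n + 1) → Fin r → Fin m)
    (hsupp : ∀ g j j', j ≠ j' → M g (T j) (T j') ≠ 0 → (∃ i, J g i = j) ∧ (∃ i, J g i = j')) :
    ∃ v, ringWinU c y (fill ρ T v) = false :=
  loss_of_affinePlusBits hp5 hcount c y ρ T lam (fun g => quadVal (M g) (b g)) F hy J (fun g => offBlock (M g) T (J g))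
    fun g => quadVal_fill_sparse (M g) (b g) ρ T (J g) (hsupp g)

end LawCplus

/-! ### §9 LAW C⁺ in first-moment form: per-register SPARSE quadratic parts are never perfect (the «spread matching-IP» suspects die) -/

section PairSparse

variable {p : ℕ} [Fact p.Prime] {n : ℕ}

/-- the off-diagonal support of a quadratic part: ordered pairs `(i, i')`, `i ≠ i'`, `M i i' ≠ 0` -/
def offSupp (M : Fin n → Fin n → ZMod p) : Finset (Fin n × Fin n) :=
  univ.filter fun ii => ii.1 ≠ ii.2 ∧ M ii.1 ii.2 ≠ 0

/-- the «bad» coordinate sets of a family of quadratic parts: the union (3 or 4 coordinates) of two supported off-diagonal pairs OF THE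
SAME REGISTER with different underlying 2-sets.  A coordinate set containing no bad set leaves every register with at most one surviving
off-diagonal pair. -/
def badSets (M : Fin (n + 1) → Fin n → Fin n → ZMod p) : Finset (Finset (Fin n)) :=
  univ.biUnion fun g => (((offSupp (M g)) ×ˢ (offSupp (M g))).filter
    (fun ee => ({ee.1.1, ee.1.2} : Finset (Fin n)) ≠ {ee.2.1, ee.2.2})).image
    (fun ee => ({ee.1.1, ee.1.2, ee.2.1, ee.2.2} : Finset (Fin n)))

/-- membership in `badSets`: the union of two supported pairs of one register with different underlying sets -/
theorem mem_badSets {M : Fin (n + 1) → Fin n → Fin n → ZMod p} {g : Fin (n + 1)} {i₁ i₁' i₂ i₂' : Fin n}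
    (h₁ : i₁ ≠ i₁') (hM₁ : M g i₁ i₁' ≠ 0) (h₂ : i₂ ≠ i₂') (hM₂ : M g i₂ i₂' ≠ 0)
    (hne : ({i₁, i₁'} : Finset (Fin n)) ≠ {i₂, i₂'}) :
    ({i₁, i₁', i₂, i₂'} : Finset (Fin n)) ∈ badSets M := by
  unfold badSets
  refine mem_biUnion.mpr ⟨g, mem_univ _, mem_image.mpr ⟨((i₁, i₁'), (i₂, i₂')), ?_, rfl⟩⟩
  refine mem_filter.mpr ⟨mem_product.mpr ⟨?_, ?_⟩, hne⟩
  · unfold offSupp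
    exact mem_filter.mpr ⟨mem_univ _, h₁, hM₁⟩
  · unfold offSupp
    exact mem_filter.mpr ⟨mem_univ _, h₂, hM₂⟩

/-- **LAW C⁺ (first-moment form, quadratic grade).**  Registers = tables of `k` linear forms and one quadratic polynomial `mod p`, NO
condition tying the registers together.  If `Σ_{s ∈ badSets M} C(n−|s|, m−|s|) < C(n, m)` (first moment: e.g. every quadratic part has
`≤ E` off-diagonal pairs and `(n+1)·E²·C(n−3, m−3) < C(n, m)`, i.e. roughly `E² m³ < n²` — all families with `O(n^{1−ε})`… in particular
`O(n)`-edge bounded-overlap families such as perfect-matching inner products once `n ≫ m⁴`) and the LAW C count holds with `p^(k+3)`, the strategy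
is not perfect: a coordinate `m`-set avoiding the bad sets leaves each register with at most ONE surviving pair on the subcube, i.e. a function
of `k+1` forms and `2` bits (`loss_of_sparseQuad`). -/
theorem loss_of_pairSparseQuad (hp5 : 5 ≤ p) {m k : ℕ}
    (hcount : (n + 1) * (p ^ (k + 1 + 2) * 2) * (2 * p - 1) ^ m < (2 * p) ^ m) (c : ℕ)
    (y : Fin (n + 1) → (Fin n → Bool) → Bool)
    (lam : Fin (n + 1) → Fin k → Fin n → ZMod p) (M : Fin (n + 1) → Fin n → Fin n → ZMod p) (b : Fin (n + 1) → Fin n → ZMod p)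
    (F : Fin (n + 1) → (Fin k → ZMod p) → ZMod p → Bool)
    (hy : ∀ g u, y g u = F g (fun j => ∑ i, if u i = true then lam g j i else 0) (quadVal (M g) (b g) u))
    (ρ : Fin n → Bool) (hB : ∑ s ∈ badSets M, (n - s.card).choose (m - s.card) < n.choose m) :
    ∃ u, ringWinU c y u = false := by
  classical
  -- the first-moment coordinate set and its enumeration
  obtain ⟨T, hTm, havoid⟩ := exists_card_avoiding (α := Fin n) m (badSets M) (by simpa [Fintype.card_fin] using hB)
  let T' : Fin m ↪ Fin n := (T.orderEmbOfFin hTm).toEmbedding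
  have hT'mem : ∀ j, T' j ∈ T := fun j => T.orderEmbOfFin_mem hTm j
  have hm : 0 < m := by
    rcases Nat.eq_zero_or_pos m with h0 | h0
    · exfalso
      have hp0 : 0 < p := by omega
      have h1 : 0 < (n + 1) * (p ^ (k + 1 + 2) * 2) := by positivity
      rw [h0, pow_zero, pow_zero, mul_one] at hcount
      omega
    · exact h0
  -- no register keeps two different surviving pairs on `T`
  have hone : ∀ g (j₁ j₁' j₂ j₂' : Fin m), j₁ ≠ j₁' → M g (T' j₁) (T' j₁') ≠ 0 → j₂ ≠ j₂' → M g (T' j₂) (T' j₂') ≠ 0 →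
      ({j₁, j₁'} : Finset (Fin m)) = {j₂, j₂'} := by
    intro g j₁ j₁' j₂ j₂' h₁ hM₁ h₂ hM₂
    by_contra hne
    have hne' : ({T' j₁, T' j₁'} : Finset (Fin n)) ≠ {T' j₂, T' j₂'} := by
      intro heq
      apply hne
      apply Finset.map_injective T'
      simpa [Finset.map_insert, Finset.map_singleton] using heq
    have hbad := mem_badSets (T'.injective.ne h₁) hM₁ (T'.injective.ne h₂) hM₂ hne'
    refine havoid _ hbad ?_
    intro i hi
    simp only [mem_insert, mem_singleton] at hi
    rcases hi with rfl | rfl | rfl | rfl <;> exact hT'mem _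
  -- positions of the (at most one) surviving pair of each register
  have hchoice : ∀ g, ∃ J : Fin 2 → Fin m, ∀ j j', j ≠ j' → M g (T' j) (T' j') ≠ 0 → (∃ i, J i = j) ∧ (∃ i, J i = j') := by
    intro g
    by_cases hex : ∃ jj : Fin m × Fin m, jj.1 ≠ jj.2 ∧ M g (T' jj.1) (T' jj.2) ≠ 0
    · obtain ⟨⟨j₀, j₀'⟩, h₀, hM₀⟩ := hex
      refine ⟨![j₀, j₀'], fun j j' hne hM => ?_⟩
      have hset := hone g j j' j₀ j₀' hne hM h₀ hM₀
      have hj : j ∈ ({j₀, j₀'} : Finset (Fin m)) := by rw [← hset]; simp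
      have hj' : j' ∈ ({j₀, j₀'} : Finset (Fin m)) := by rw [← hset]; simp
      simp only [mem_insert, mem_singleton] at hj hj'
      refine ⟨?_, ?_⟩
      · rcases hj with h | h
        · exact ⟨0, by simp [h]⟩
        · exact ⟨1, by simp [h]⟩
      · rcases hj' with h | h
        · exact ⟨0, by simp [h]⟩
        · exact ⟨1, by simp [h]⟩
    · exact ⟨fun _ => ⟨0, hm⟩, fun j j' hne hM => absurd ⟨(j, j'), hne, hM⟩ hex⟩
  choose J hJ using hchoice
  obtain ⟨v, hv⟩ := loss_of_sparseQuad hp5 hcount c y lam M b F hy T' ρ J hJ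
  exact ⟨_, hv⟩

end PairSparse

end Summit.QuantumAdvantage.QuantumAdvantage.Theorems.InnerDegreeDial
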